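import Literature.Topology.FourManifolds.ThickenedPlanarHandlebody
import Literature.Topology.FourManifolds.MorseBirthInsertion
import Literature.Topology.FourManifolds.MorseExtrema
import Mathlib.Analysis.InnerProductSpace.Calculus
import HarnessLib

/-!
# Planar Morse functions with `g` saddles: genus-`g` handlebodies in `ℝ³` for every `g`

Topic `Literature/Topology/FourManifolds`; fact seat
`provefact-Literature.IsHandlebody.exists_diffeomorph_isOrientationReversing_boundary` (F2b₂, "every
handlebody admits an orientation-reversing symmetry", Juhász (2023), §3.5, p. 97), sequel of
`ThickenedPlanarHandlebody.lean`, which proved that the thickening `{q(x, y) + z² ≤ c} ⊂ ℝ³`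
of a planar Morse function `q` *presenting a disc with `g` holes below `c`*
(`Literature.IsHoledDiscMorseFunction g q c`: coercive, one minimum and `g` saddles below `c`, all
maxima above `c`) is a genus-`g` handlebody, symmetric under `z ↦ -z`.  This file **constructs
such `q` for every `g`** and concludes that **genus-`g` handlebodies exist in `ℝ³` for every
`g`**, mirror-symmetric — the models consumed by the proof of the one-model fact SYMM
`Literature.Topology.FourManifolds.exists_isHandlebody_isOrientationReversing` (`LickorishWallaceHandlebodies.lean`).
Everything here is **proved**.

* §1 `Literature.Topology.FourManifolds.PlanarMorse.normSq` — the base case `q₀(u) = ‖u‖²` on `ℝ²`: a Morse function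
  (`isMorse_normSq`; Hessian `2⟨·, ·⟩`, `mhessian_normSq_apply`) with the origin as only
  critical point (`criticalSet_normSq`), of index `0` (`morseIndex_normSq_zero`, a minimum,
  `Literature.Topology.FourManifolds.IsLocalMin.morseIndex_eq_zero`);
  `isHoledDiscMorseFunction_normSq : IsHoledDiscMorseFunction 0 normSq 1`.
* §2 `Literature.Topology.FourManifolds.IsHoledDiscMorseFunction.succ` — **the induction step** `g ↦ g + 1`: the critical
  values of `q` stay `4δ` away from `c` (`exists_gap`), the level `c` is attained
  (`exists_apply_eq`, intermediate value theorem along a segment from the minimum to a far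
  point, using coercivity), and Milnor's insertion of a pair of auxiliary nondegenerate critical
  points of indices `1`, `2` (*Lectures on the h-cobordism theorem* (1965), Lemma 8.2 and the
  proof of Thm. 8.1; in the tree `Literature.Topology.FourManifolds.IsMorse.exists_insert_birthPair`, `MorseBirthInsertion.lean`)
  at a point of the level `c`, supported in the band `|q - c| < δ` and moving `q` by `< δ`,
  yields `q'` with one more saddle `a` and one more maximum `b`, `q' a < q' b`, old critical
  points, values and indices untouched; the new level `c' = (q' a + q' b) / 2` lies in
  `(c - 2δ, c + 2δ)`, above the old saddles and the minimum (values `≤ c - 4δ`) and the new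
  saddle, below the old maxima (values `≥ c + 4δ`) and the new maximum.
* §3 `Literature.Topology.FourManifolds.exists_isHoledDiscMorseFunction` (all `g`, by induction),
  `Literature.Topology.FourManifolds.exists_even_isHandlebody` (**for every `g` a smooth `F : ℝ³ → ℝ`, even in `z`, with a
  regular level `c` such that `{F ≤ c}` is a genus-`g` handlebody**) and
  `Literature.Topology.FourManifolds.exists_isHandlebody` (`Literature.IsHandlebody g` is inhabited for every `g`; previously known in
  the tree for `g ≤ 1`: `Literature.Topology.FourManifolds.isHandlebody_zero_closedBall`,
  `Literature.Topology.FourManifolds.SolidTorusModel.isHandlebody_one_solidTorus`).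

## References

* J. Milnor, *Lectures on the h-cobordism theorem*, notes by L. Siebenmann and J. Sondow,
  Princeton (1965), Lemma 8.2 (PDF pp. 54–55) and proof of Thm. 8.1 (PDF p. 56).
  [MilnorHCobordism1965]
* J. Milnor, *Morse theory*, Ann. of Math. Studies 51 (1963), §2. [Milnor1963]
* A. Juhász, *Differential and Low-Dimensional Topology*, LMS Student Texts 104 (2023), §3.5,
  pp. 96–97. [Juhasz2023]
* J. Schultens, *Introduction to 3-Manifolds*, GSM 151 (2014), Def. 6.1.5. [Schultens2014]
-/

open scoped Manifold ContDiff Topology InnerProductSpace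
open Set Function Filter Metric Module

noncomputable section

namespace Literature.Topology.FourManifolds

universe u

/-- Local notation: `𝔼 n` is the model Euclidean space `EuclideanSpace ℝ (Fin n)`. -/
local notation "𝔼 " n:arg => EuclideanSpace ℝ (Fin n)

namespace PlanarMorse

/-! ### §1 The base case: `‖u‖²` on the plane -/

/-- The squared norm `q₀(u) = ‖u‖²` on `ℝ²`. [folklore] -/
def normSq (u : 𝔼 2) : ℝ := ‖u‖ ^ 2

/-- Unfolding of `q₀`. [folklore] -/
theorem normSq_apply (u : 𝔼 2) : normSq u = ‖u‖ ^ 2 := rfl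

/-- `q₀` is smooth. [folklore] -/
theorem contDiff_normSq : ContDiff ℝ ∞ normSq := contDiff_norm_sq ℝ

/-- `dq₀ = 2⟨u, ·⟩`. [folklore] -/
theorem fderiv_normSq : fderiv ℝ normSq = fun u => 2 • innerSL ℝ u := by
  funext u
  exact fderiv_norm_sq_apply u

/-- `dq₀ = 2⟨u, ·⟩`, with a real scalar. [folklore] -/
theorem fderiv_normSq' :
    fderiv ℝ normSq =
      fun u => ((2 : ℝ) • (innerSL ℝ : 𝔼 2 →L[ℝ] 𝔼 2 →L[ℝ] ℝ)) u := by
  rw [fderiv_normSq]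
  funext u
  rw [two_smul, smul_apply, two_smul]

/-- `D²q₀ = 2⟨·, ·⟩` at every point. [folklore] -/
theorem fderiv_fderiv_normSq_apply (u v w : 𝔼 2) :
    fderiv ℝ (fderiv ℝ normSq) u v w = 2 * ⟪v, w⟫_ℝ := by
  rw [fderiv_normSq', ContinuousLinearMap.fderiv, smul_apply, smul_apply, innerSL_apply_apply,
    smul_eq_mul]

/-- The only critical point of `q₀` is the origin. [folklore] -/
theorem isMCriticalPt_normSq_iff (u : 𝔼 2) : IsMCriticalPt (𝓡 2) normSq u ↔ u = 0 := by
  rw [MorseBirth.isMCriticalPt_iff_fderiv, fderiv_normSq]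
  constructor
  · intro h
    have h2 : (2 • innerSL ℝ u) u = (0 : 𝔼 2 →L[ℝ] ℝ) u := by
      have h' : 2 • innerSL ℝ u = (0 : 𝔼 2 →L[ℝ] ℝ) := h
      rw [h']
    rw [two_smul, add_apply, innerSL_apply_apply, real_inner_self_eq_norm_sq] at h2
    have h3 : ‖u‖ ^ 2 = 0 := by
      have : (0 : 𝔼 2 →L[ℝ] ℝ) u = 0 := rfl
      nlinarith [sq_nonneg ‖u‖, h2, this]
    exact norm_eq_zero.1 (pow_eq_zero_iff two_ne_zero |>.1 h3)
  · rintro rfl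
    simp

/-- `crit q₀ = {0}`. [folklore] -/
theorem criticalSet_normSq : criticalSet (𝓡 2) normSq = {0} := by
  ext u; simp [isMCriticalPt_normSq_iff]

/-- The Hessian of `q₀` is `2⟨·, ·⟩`. [folklore] -/
theorem mhessian_normSq_apply (u v w : 𝔼 2) :
    mhessian (𝓡 2) normSq u v w = 2 * ⟪v, w⟫_ℝ := by
  rw [MorseBirth.mhessian_model_apply, fderiv_fderiv_normSq_apply]

/-- The Hessian of `q₀` is nondegenerate. [folklore] -/
theorem nondegenerate_mhessian_normSq (u : 𝔼 2) :
    (mhessian (𝓡 2) normSq u).Nondegenerate := by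
  refine ⟨fun v hv => ?_, fun v hv => ?_⟩ <;>
  · have h := hv v
    rw [mhessian_normSq_apply] at h
    have h' : ⟪v, v⟫_ℝ = 0 := by linarith
    exact inner_self_eq_zero.mp h'

/-- **`q₀ = ‖u‖²` is a Morse function on the plane.** [folklore] -/
theorem isMorse_normSq : IsMorse (𝓡 2) normSq :=
  ⟨contMDiff_iff_contDiff.2 contDiff_normSq, fun u _ => nondegenerate_mhessian_normSq u⟩

/-- The origin is a critical point of index `0` (a minimum). [cite: Milnor1963, §2] -/
theorem morseIndex_normSq_zero : morseIndex (𝓡 2) normSq 0 = 0 :=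
  IsLocalMin.morseIndex_eq_zero
    ((contMDiff_iff_contDiff.2 (contDiff_normSq.of_le (by norm_cast))) 0)
    (Filter.Eventually.of_forall fun u => by simp [normSq])

/-- The critical points of `q₀` of index `i`: the origin for `i = 0`, none otherwise.
[folklore] -/
theorem criticalSetOfIndex_normSq (i : ℕ) :
    criticalSetOfIndex (𝓡 2) normSq i = if i = 0 then {0} else ∅ := by
  ext u
  simp only [mem_criticalSetOfIndex, isMCriticalPt_normSq_iff]
  constructor
  · rintro ⟨rfl, hi⟩
    rw [morseIndex_normSq_zero] at hi
    subst hi; simp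
  · intro hu
    split_ifs at hu with hi
    · simp only [mem_singleton_iff] at hu
      subst hu; subst hi
      exact ⟨rfl, morseIndex_normSq_zero⟩
    · exact absurd hu (notMem_empty _)

/-- **Base case**: `‖u‖²` presents a disc with no holes below the level `1`. [folklore] -/
theorem isHoledDiscMorseFunction_normSq : IsHoledDiscMorseFunction 0 normSq 1 where
  isMorse := isMorse_normSq
  exists_bound := ⟨0, fun u => by simp [normSq]⟩
  finite_criticalSet := by rw [criticalSet_normSq]; exact finite_singleton 0
  exists_index_zero := ⟨0, by rw [criticalSetOfIndex_normSq]; simp, by simp [normSq]⟩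
  ncard_index_one := by rw [criticalSetOfIndex_normSq]; simp
  lt_of_index_one := fun u hu => by rw [criticalSetOfIndex_normSq] at hu; simp at hu
  lt_of_index_two := fun u hu => by rw [criticalSetOfIndex_normSq] at hu; simp at hu

end PlanarMorse

/-! ### §2 The induction step: inserting a saddle–maximum pair near the level `c` -/

namespace IsHoledDiscMorseFunction

variable {g : ℕ} {q : 𝔼 2 → ℝ} {c : ℝ}

/-- `q` is continuous. [folklore] -/
theorem continuous (h : IsHoledDiscMorseFunction g q c) : Continuous q :=
  (PlanarThickening.contDiff_of_isMorse h.isMorse).continuous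

/-- **The critical values stay a definite distance away from `c`**: there is `δ > 0` with
`4δ ≤ |q u - c|` for every critical point `u` (finitely many critical values, none equal to
`c`). [folklore] -/
theorem exists_gap (h : IsHoledDiscMorseFunction g q c) :
    ∃ δ > 0, ∀ u ∈ criticalSet (𝓡 2) q, 4 * δ ≤ |q u - c| := by
  have hfin : (q '' criticalSet (𝓡 2) q).Finite := h.finite_criticalSet.image q
  have hc : c ∉ q '' criticalSet (𝓡 2) q := by
    rintro ⟨u, hu, huc⟩
    exact h.apply_ne_of_isMCriticalPt hu huc
  obtain ⟨ε, hε, hball⟩ := Metric.isOpen_iff.1 hfin.isClosed.isOpen_compl c hc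
  refine ⟨ε / 4, by positivity, fun u hu => ?_⟩
  have hu' : q u ∉ ball c ε := fun hmem => hball hmem ⟨u, hu, rfl⟩
  rw [mem_ball, Real.dist_eq, not_lt] at hu'
  linarith

/-- **The level `c` is attained** (at a regular point): `q u₀ < c` at the minimum and
`q → ∞` by coercivity, so `q = c` somewhere on a segment (intermediate value theorem).
[folklore] -/
theorem exists_apply_eq (h : IsHoledDiscMorseFunction g q c) : ∃ z, q z = c := by
  obtain ⟨u₀, -, hc0⟩ := h.exists_index_zero
  obtain ⟨B, hB⟩ := h.exists_bound
  set R : ℝ := |c| + |B| + 1 with hR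
  set u₁ : 𝔼 2 := EuclideanSpace.single 0 R with hu₁
  have hR1 : 1 ≤ R := by
    have := abs_nonneg c; have := abs_nonneg B; linarith
  have hnorm : ‖u₁‖ ^ 2 = R ^ 2 := by
    rw [hu₁, EuclideanSpace.norm_sq_eq, Fin.sum_univ_two]
    simp [sq_abs]
  have hq₁ : c ≤ q u₁ := by
    have h1 := hB u₁
    rw [hnorm] at h1
    nlinarith [le_abs_self c, le_abs_self B, hR1]
  -- intermediate value theorem on the segment from `u₀` to `u₁`
  set γ : ℝ → 𝔼 2 := fun t => u₀ + t • (u₁ - u₀) with hγ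
  have hγc : Continuous (q ∘ γ) :=
    h.continuous.comp (continuous_const.add (continuous_id.smul continuous_const))
  have h0 : (q ∘ γ) 0 = q u₀ := by simp [hγ]
  have h1 : (q ∘ γ) 1 = q u₁ := by simp [hγ]
  have hmem : c ∈ Icc ((q ∘ γ) 0) ((q ∘ γ) 1) := by
    rw [h0, h1]; exact ⟨hc0.le, hq₁⟩
  obtain ⟨t, -, ht⟩ := intermediate_value_Icc zero_le_one hγc.continuousOn hmem
  exact ⟨γ t, ht⟩

/-- **Induction step.** If `q` presents a disc with `g` holes below `c`, then inserting a pair of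
auxiliary critical points of indices `1`, `2` (Milnor 1965, Lemma 8.2, in the tree's form
`Literature.Topology.FourManifolds.IsMorse.exists_insert_birthPair`) at a point of the regular level `c`, inside the thin band
`|q - c| < δ` and moving `q` by less than `δ`, where `4δ` separates `c` from all critical values,
produces `q'` presenting a disc with `g + 1` holes below the new level `c' = (q' a + q' b)/2`
between the new saddle `a` and the new maximum `b`: the old critical points keep their values
and indices, the old saddles and the minimum stay below `c - 4δ < c' `, the old maxima above
`c + 4δ > c'`.
[cite: MilnorHCobordism1965, Lemma 8.2 and proof of Thm. 8.1 (PDF pp. 54–56)] -/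
theorem succ (h : IsHoledDiscMorseFunction g q c) :
    ∃ (q' : 𝔼 2 → ℝ) (c' : ℝ), IsHoledDiscMorseFunction (g + 1) q' c' := by
  obtain ⟨δ, hδ, hgap⟩ := h.exists_gap
  obtain ⟨z, hz⟩ := h.exists_apply_eq
  have hzreg : ¬ IsMCriticalPt (𝓡 2) q z := fun hcrit => h.apply_ne_of_isMCriticalPt hcrit hz
  have hzint : (𝓡 2).IsInteriorPoint z := isInteriorPoint_euclidean z
  set U : Set (𝔼 2) := q ⁻¹' ball c δ with hU_def
  have hU : U ∈ 𝓝 z :=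
    h.continuous.continuousAt.preimage_mem_nhds (by rw [hz]; exact ball_mem_nhds c hδ)
  obtain ⟨q', hq'M, -, hε, hev, hidx, a, b, haU, hbU, hab, ha, hb, hcrit, hia, hib, hlt⟩ :=
    h.isMorse.exists_insert_birthPair hzint hzreg hU (k := 1) (by norm_num) hδ
  -- numerical bookkeeping
  have hqa : |q a - c| < δ := by
    have : a ∈ q ⁻¹' ball c δ := haU
    simpa [Real.dist_eq] using this
  have hqb : |q b - c| < δ := by
    have : b ∈ q ⁻¹' ball c δ := hbU
    simpa [Real.dist_eq] using this
  have hεa := hε a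
  have hεb := hε b
  rw [abs_lt] at hqa hqb hεa hεb
  set c' : ℝ := (q' a + q' b) / 2 with hc'
  have hc'lo : c - 2 * δ < c' := by rw [hc']; linarith
  have hc'hi : c' < c + 2 * δ := by rw [hc']; linarith
  have hold : ∀ u ∈ criticalSet (𝓡 2) q, q' u = q u := fun u hu => (hev u hu).eq_of_nhds
  have hlow : ∀ u ∈ criticalSet (𝓡 2) q, q u < c → q' u < c' := by
    intro u hu hlt'
    have h4 := hgap u hu
    rw [abs_of_neg (by linarith), neg_sub] at h4
    rw [hold u hu]
    linarith
  have hhigh : ∀ u ∈ criticalSet (𝓡 2) q, c < q u → c' < q' u := by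
    intro u hu hlt'
    have h4 := hgap u hu
    rw [abs_of_pos (by linarith)] at h4
    rw [hold u hu]
    linarith
  -- membership in the new critical set
  have hmem : ∀ u, IsMCriticalPt (𝓡 2) q' u ↔
      u = a ∨ u = b ∨ u ∈ criticalSet (𝓡 2) q := by
    intro u
    change u ∈ criticalSet (𝓡 2) q' ↔ _
    rw [hcrit]
    simp only [mem_insert_iff]
  have hfin' : (criticalSet (𝓡 2) q').Finite := by
    rw [hcrit]; exact (h.finite_criticalSet.insert b).insert a
  obtain ⟨u₀, h0, hc0⟩ := h.exists_index_zero
  have hu₀ : u₀ ∈ criticalSetOfIndex (𝓡 2) q 0 := by rw [h0]; exact mem_singleton u₀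
  refine ⟨q', c', ⟨hq'M, ?_, hfin', ⟨u₀, ?_, hlow u₀ hu₀.1 hc0⟩, ?_, ?_, ?_⟩⟩
  · -- coercivity
    obtain ⟨B, hB⟩ := h.exists_bound
    refine ⟨B + δ, fun u => ?_⟩
    have h1 := hε u
    have h2 := hB u
    rw [abs_lt] at h1
    linarith
  · -- the minimum
    ext u
    simp only [mem_criticalSetOfIndex, mem_singleton_iff, hmem]
    constructor
    · rintro ⟨hu, hi⟩
      rcases hu with rfl | rfl | hu
      · rw [hia] at hi; exact absurd hi one_ne_zero
      · rw [hib] at hi; exact absurd hi (by norm_num)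
      · rw [hidx u hu] at hi
        have : u ∈ criticalSetOfIndex (𝓡 2) q 0 := ⟨hu, hi⟩
        rwa [h0, mem_singleton_iff] at this
    · rintro rfl
      exact ⟨Or.inr (Or.inr hu₀.1), by rw [hidx _ hu₀.1]; exact hu₀.2⟩
  · -- `g + 1` saddles
    have heq : criticalSetOfIndex (𝓡 2) q' 1 = insert a (criticalSetOfIndex (𝓡 2) q 1) := by
      ext u
      simp only [mem_criticalSetOfIndex, mem_insert_iff, hmem]
      constructor
      · rintro ⟨hu, hi⟩
        rcases hu with rfl | rfl | hu
        · exact Or.inl rfl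
        · rw [hib] at hi; exact absurd hi (by norm_num)
        · exact Or.inr ⟨hu, by rwa [hidx u hu] at hi⟩
      · rintro (rfl | ⟨hu, hi⟩)
        · exact ⟨Or.inl rfl, hia⟩
        · exact ⟨Or.inr (Or.inr hu), by rw [hidx u hu]; exact hi⟩
    rw [heq, ncard_insert_of_notMem (fun hmem' => ha hmem'.1)
      (h.finite_criticalSet.subset (criticalSetOfIndex_subset _ _ _)), h.ncard_index_one]
  · -- saddles below `c'`
    rintro u ⟨hu, hi⟩
    rcases (hmem u).1 hu with rfl | rfl | hu
    · rw [hc']; linarith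
    · rw [hib] at hi; exact absurd hi (by norm_num)
    · rw [hidx u hu] at hi
      exact hlow u hu (h.lt_of_index_one u ⟨hu, hi⟩)
  · -- maxima above `c'`
    rintro u ⟨hu, hi⟩
    rcases (hmem u).1 hu with rfl | rfl | hu
    · rw [hia] at hi; exact absurd hi (by norm_num)
    · rw [hc']; linarith
    · rw [hidx u hu] at hi
      exact hhigh u hu (h.lt_of_index_two u ⟨hu, hi⟩)

end IsHoledDiscMorseFunction

/-! ### §3 Planar Morse functions with `g` saddles exist for every `g`; genus-`g` handlebodies -/

/-- **For every `g` there is a planar Morse function presenting a disc with `g` holes**: start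
from `‖u‖²` (one minimum) and insert `g` saddle–maximum pairs (Milnor 1965, Lemma 8.2).
[cite: MilnorHCobordism1965, Lemma 8.2 (PDF pp. 54–55)] -/
theorem exists_isHoledDiscMorseFunction :
    ∀ g : ℕ, ∃ (q : 𝔼 2 → ℝ) (c : ℝ), IsHoledDiscMorseFunction g q c
  | 0 => ⟨_, _, PlanarMorse.isHoledDiscMorseFunction_normSq⟩
  | g + 1 => by
    obtain ⟨q, c, h⟩ := exists_isHoledDiscMorseFunction g
    exact h.succ

/-- **Genus-`g` handlebodies in `ℝ³`, symmetric under `z ↦ -z`, exist for every `g`**: the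
thickenings `{q(x, y) + z² ≤ c}` (`ThickenedPlanarHandlebody.lean`) of the planar Morse
functions
above. Juhász (2023), §3.5, p. 96 (a genus-`g` handlebody as "a regular neighbourhood of a wedge
of `g` unknotted circles in `ℝ³`"). [cite: Juhasz2023, §3.5 (p. 96)] -/
theorem exists_even_isHandlebody (g : ℕ) :
    ∃ (F : 𝔼 3 → ℝ) (c : ℝ) (hF : IsRegularLevel (𝓡 3) F c),
      (∀ p p' : 𝔼 3, p' 0 = p 0 → p' 1 = p 1 → p' 2 = -p 2 → F p' = F p) ∧
        IsHandlebody g (RegularSublevel hF) := by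
  obtain ⟨q, c, h⟩ := exists_isHoledDiscMorseFunction g
  exact h.exists_even_isHandlebody

/-- **`Literature.IsHandlebody g` is inhabited for every `g`** (so far the tree had `g = 0`,
`Literature.Topology.FourManifolds.isHandlebody_zero_closedBall`, and `g = 1`,
`Literature.Topology.FourManifolds.SolidTorusModel.isHandlebody_one_solidTorus`):
a genus-`g` handlebody in `Type`, Hausdorff and second countable (a regular sublevel set of
`ℝ³`). Schultens (2014), Def. 6.1.5; Juhász (2023), §3.5. [cite: Juhasz2023, §3.5 (p. 96)] -/
theorem exists_isHandlebody (g : ℕ) :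
    ∃ (H : Type) (_ : TopologicalSpace H) (_ : T2Space H) (_ : SecondCountableTopology H)
      (_ : ChartedSpace (EuclideanHalfSpace 3) H) (_ : IsManifold (𝓡∂ 3) ∞ H),
      IsHandlebody g H := by
  obtain ⟨F, c, hF, -, hH⟩ := exists_even_isHandlebody g
  exact ⟨RegularSublevel hF, inferInstance, inferInstance, inferInstance, inferInstance,
    inferInstance, hH⟩



end Literature.Topology.FourManifolds
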